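import Summits.QuantumFields.BalabanUV.Beta.GAN24.BiStencilZeroMode

/-!
# (C)sym at level 0 — a COARSE-BOND-indexed covariant family against a block-periodic form: every first-slot term of the zero mode is
# the same cell pairing (blueprint link (E4), CORRECTED)

WHAT. In the zero mode `zmode Lc T = Σ_{u ∈ box Lc} Σ'_{u′} Σ'_x Σ'_z T κ u κ′ u′ x z …` of the LEVEL-1 table the first bond position `u` runs over one
cell of the COARSE lattice, and the level-0 exchange word is, after the inner resummations, `Σ_{u ∈ box} Σ'_y Σ_l j_u(l, y)·A(l, y)` with a family
`j_u` indexed by the coarse bond `u` — the source enters only through the fine point `Lc•u`, so the family is covariant in the shape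
`j_{u+t}(l, y + Lc•t) = j_u(l, y)` for EVERY `t ∈ ℤ^{d+1}` (`OneStepKernelFamily.vertexOfK_translate`) — and `A` a block-periodic 1-form.  This is NOT
the shape of `CovariantFamilyCellPairing` (family index a FINE site, `j (u + N•t) l (y + N•t) = j u l y`): here ALL `|box| = N^{d+1}` first-slot terms are
EQUAL, and each is the cell pairing of the resummed family with `A`:

* `tsum_mul_periodic_of_cov` (one direction): `Σ'_y j_u(y)·A(y) = Σ_{r ∈ box} (Σ'_v j_v(r))·A(r)` for every `u`;
* `tsum_sum_mul_periodic_of_cov` (1-forms): `Σ'_y Σ_l j_u(l,y)·A(l,y) = Σ_{r ∈ box} Σ_l (Σ'_v j_v(l,r))·A(l,r)` for every `u`;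
* **`sum_box_tsum_sum_mul_periodic_of_cov`**: `Σ_{u ∈ box} Σ'_y Σ_l j_u(l,y)·A(l,y) = |box|·Σ_{r ∈ box} Σ_l (Σ'_v j_v(l,r))·A(l,r)`.

Only the summability of `y ↦ j_u(l,y)·A(l,y)` is assumed (the reindexing `v = u − t` of the resummed family is an equivalence of `ℤ^{d+1}`, no summability
needed).  In the (C)sym level-0 EE word (leaf-04 g65 blueprint §4–§5) this supplies the factor `|box| = Lc^{d+1}` that `FaceCurrentExchangeValue.card_mul_pairing_face`
carries on its left — the blueprint's (E4) invoked `CovariantFamilyCellPairing` and so DROPPED this factor; corrected here.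

HONEST: [folklore] `tsum` ∕ finite cell algebra BY NAME over leaf-02's `BiStencilZeroMode.tsum_mul_periodic`; no value of Bałaban's tables is asserted;
(C)sym stays DISPLAYED — nothing of (C)∕(Q-D)∕(Q-D-rate) is discharged; NEVER «G-an2-4 closed» as (CONV-C); NOT D1, NOT BetaPertH, NOT continuum, NOT Clay.
-/

noncomputable section

open Finset
open scoped BigOperators
open Literature.MathematicalPhysics.QuantumFieldTheory
open Literature.MathematicalPhysics.QuantumFieldTheory.Balaban1983to89.Beta
open AffineAveraging (Form1 Site box toSite)
open Summit.QuantumFields.BalabanUV.Beta.GAN24.BiStencilZeroMode (tsum_mul_periodic)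

namespace Summit.QuantumFields.BalabanUV.Beta.GAN24.CoarseBondCellPairing

variable {d N : ℕ} [NeZero N]

/-- [folklore] **A COARSE-BOND-COVARIANT FAMILY AGAINST A PERIODIC FUNCTION** (one direction): if `j (u + t) (y + N•t) = j u y` for all `t` and `A` is
`N`-periodic, then for EVERY source position `u`, `Σ'_y j u y·A y = Σ_{r ∈ box} (Σ'_v j v r)·A r` (cell decomposition against the periodic `A`, then the
reindexing `v = u − t`). -/
theorem tsum_mul_periodic_of_cov {j : Site (d + 1) → Site (d + 1) → ℝ} {A : Site (d + 1) → ℝ}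
    (hcov : ∀ u y t, j (u + t) (y + (N : ℤ) • t) = j u y) (hA : ∀ y t, A (y + (N : ℤ) • t) = A y) (u : Site (d + 1))
    (hjy : Summable fun y => j u y * A y) :
    ∑' y, j u y * A y = ∑ r ∈ box (d + 1) N, (∑' v, j v (toSite r)) * A (toSite r) := by
  rw [tsum_mul_periodic (N := N) hA hjy]
  refine Finset.sum_congr rfl fun r _ => ?_
  rw [mul_comm]
  congr 1
  have e : ∀ t : Site (d + 1), j u ((N : ℤ) • t + toSite r) = j (u - t) (toSite r) := by
    intro t
    have h := hcov (u - t) (toSite r) t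
    rw [sub_add_cancel, add_comm] at h
    exact h
  rw [tsum_congr e]
  exact (Equiv.subLeft u).tsum_eq (fun v => j v (toSite r))

/-- [folklore] The same for 1-forms (a finite direction index carried along): `Σ'_y Σ_l j u l y·A l y = Σ_{r ∈ box} Σ_l (Σ'_v j v l r)·A l r` for every `u`. -/
theorem tsum_sum_mul_periodic_of_cov {j : Site (d + 1) → Form1 (d + 1) ℝ} {A : Form1 (d + 1) ℝ}
    (hcov : ∀ u l y t, j (u + t) l (y + (N : ℤ) • t) = j u l y) (hA : ∀ l y t, A l (y + (N : ℤ) • t) = A l y) (u : Site (d + 1))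
    (hjy : ∀ l, Summable fun y => j u l y * A l y) :
    ∑' y, ∑ l, j u l y * A l y = ∑ r ∈ box (d + 1) N, ∑ l, (∑' v, j v l (toSite r)) * A l (toSite r) := by
  rw [Summable.tsum_finsetSum (fun l _ => hjy l), Finset.sum_comm]
  exact Finset.sum_congr rfl fun l _ =>
    tsum_mul_periodic_of_cov (N := N) (j := fun u y => j u l y) (A := A l) (fun u y t => hcov u l y t) (fun y t => hA l y t) u (hjy l)

/-- [folklore] **EVERY FIRST-SLOT TERM OF THE ZERO MODE IS THE SAME CELL PAIRING**: for a coarse-bond-covariant family (`j (u + t) l (y + N•t) = j u l y`,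
all `t`) and an `N`-periodic 1-form `A`,
`Σ_{u ∈ box} Σ'_y Σ_l j u l y·A l y = |box|·Σ_{r ∈ box} Σ_l (Σ'_v j v l r)·A l r` (`|box| = N^{d+1}` equal terms). -/
theorem sum_box_tsum_sum_mul_periodic_of_cov {j : Site (d + 1) → Form1 (d + 1) ℝ} {A : Form1 (d + 1) ℝ}
    (hcov : ∀ u l y t, j (u + t) l (y + (N : ℤ) • t) = j u l y) (hA : ∀ l y t, A l (y + (N : ℤ) • t) = A l y)
    (hjy : ∀ u l, Summable fun y => j u l y * A l y) :
    ∑ u ∈ box (d + 1) N, ∑' y, ∑ l, j (toSite u) l y * A l y =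
      ((box (d + 1) N).card : ℝ) * ∑ r ∈ box (d + 1) N, ∑ l, (∑' v, j v l (toSite r)) * A l (toSite r) := by
  rw [Finset.sum_congr rfl fun u _ => tsum_sum_mul_periodic_of_cov (N := N) hcov hA (toSite u) (hjy (toSite u)), Finset.sum_const, nsmul_eq_mul]

end Summit.QuantumFields.BalabanUV.Beta.GAN24.CoarseBondCellPairing

end
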